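import Literature.IUT.HodgeTheaters.TemperedCoveringsCor23viHatIncidenceReduction
import Literature.IUT.HodgeTheaters.StableCurveTemperedDataOfSpecialFibreCuspedPiDataNVExposed
import Literature.AnabelianGeometry.SemiGraphs.ProfiniteFreeTwoElevation
import Literature.AnabelianGeometry.SemiGraphs.TemperedDecompositionSingleVertex
import Literature.AnabelianGeometry.SemiGraphs.TemperedEdgeLikeProofs
import HarnessLib

/-!
# [IUTchI] Cor. 2.3 (vi) at the genuine datum: the binders `{hF, hdict}` of the hat-incidence reduction JOINTLY
# INHABITED — with a cusp AND an open edge carrying its inertia — at a one-vertex-ONE-CUSP `PiData` witness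

S. Mochizuki, *Inter-universal Teichmüller theory I*, kurims manuscript (May 2020), §2, Cor. 2.3 (vi) p. 48
[cite: Mochizuki2012, Cor 2.3(vi) p.48] (D-0012 claim key; nothing of the series is asserted here); S. Mochizuki,
*Semi-graphs of anabelioids*, Publ. RIMS **42** (2006), Ex. 3.10 p. 44 (the cusps of `X_K` ↔ the open edges of
`G^c`), §6 p. 71 ("`I_x := D_x ∩ Δ^temp_X` is isomorphic to `Ẑ(1)`"), Thm. 3.7 (iii) p. 41 (edge-like subgroups)
[cite: MochizukiSemiAnbd2006, Ex 3.10 p.44].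

PROOF-ONLY non-vacuity companion (abc-iut cell, seat abc-iut-w4-d059 gen 8, row «COR23VI-HATH-PROSIGMA» item N1 of
abc-iut-L5-lead RULINGS #114 (2); no definition, no instance, no new `Prop` fact — every construction is a term inside
an `∃`) of `TemperedCoveringsCor23viHatIncidenceReduction.lean` (p492945), whose closer
`cor23vi_ofSpecialFibre_closureH_piDataTpH_of_hatEdgeIncidence` proves Cor. 2.3 (vi) AS TYPED at the genuine 𝔛-datum
from `hF` (pro-`Σ̂` edge–subgraph incidence — a displayed FACT-CANDIDATE, GAP row G-w4d059-g8-1) and `hdict` (the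
cusp ↦ OPEN-edge dictionary: `J_x = S.admissible(I_x ∩ Δ)` is an EDGE-LIKE subgroup of an open edge `e_x` whose only
vertex is `vtx x`).  abc-iut-w4-d070's witness (p491002) has an EDGELESS base fibre, where `hdict` cannot be
inhabited.  HERE the base fibre is replaced by abc-iut-L3-t11's ONE-VERTEX-ONE-CUSP semi-graph of anabelioids
`OneVertexCusps.restrictGraph ⊤ (fun _ => TwistedCusps.cusp 0) …` over `F̂₂` (vertex group `F̂₂`, one open edge with
edge group the closed procyclic `C₀ = cl η⟨a⟩`; Thm. 3.7 hypotheses `TwistedCusps.restrict_thm37Hypotheses_cusp`;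
chart `OneVertexCusps.restrictChart` with `π₁^temp = F̂₂` on the nose), kept over abc-iut-L3's cusped free-profinite
𝔛-datum (`PiData.exists_temperedCurve_freeProfiniteTwo_cusped_exposed`: `Δ ≃ F̂₂`, one cusp `x` with `I_x ∩ Δ ↦ C₀`):

* `TwistedCusps.eq_cusp_zero_of_zHat` — a copy `Z ≅ Ẑ` of `Ẑ` in `F̂₂` containing `η(a)` IS `C₀` (malnormality of
  `C₀`, `TwistedCusps.cusp_inf_conj_self_eq_bot`);
* `OneVertexCusps.exists_bijective_isVerticialHom_restrictChart` — the generic one-vertex cusped chart admits a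
  BIJECTIVE verticial homomorphism `φ : Π_v ⥲ π₁^temp` (Prop. 3.6 (ii) compatible isomorphism of the chart with
  itself, `TemperedPiChart.exists_compatIso`, read through `isDecompHom_singleVertex_iff`);
* **`exists_hatEdgeIncidence_cuspEdgeDict_jointly`** — THERE ARE `X`, `d`, a special-fibre datum `S` WITH AN OPEN
  EDGE, `T`, an origin record `P : PiData X d S T` and a cusp such that for EVERY level `i` and EVERY
  `h36 : S.Gc.Prop36Hypotheses`: `hdict` holds NON-DEGENERATELY (the branch `(⋆, true)` of the edge abuts to the
  vertex met by the cusp, the branch `(⋆, false)` to nothing, and `J_x` IS an edge-like subgroup of that edge —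
  `map_branchSubgroup_mem_edgeLikeSubgroups` along `φ`) and `hF` holds at `(P.TpH, P.H)` (its conclusion "some
  branch of `e` abuts to a vertex of `ℍ`" is met by `(e, true)`, `ℍ` containing the only vertex — `hF` stays
  LABELLED a general FACT-CANDIDATE, inhabited here for the one-vertex reason, exactly as `hhatH` was in p491002);
* `exists_cor23vi_ofSpecialFibre_of_hatEdgeIncidence` — hence the p492945 closer FIRES there: Cor. 2.3 (vi) AS TYPED
  holds at `ofSpecialFibre X d S h36 Σ Σ̂ … P.TpH (closure ι P.TpH) _ (x ↦ ξ_x meets P.H)`.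

HONEST LIMITS (those of the carrier, verbatim in substance): consistency evidence for OUR binders only — `Π^temp` is a
direct product and profinite, one closed point, one-vertex fibres (levels edgeless; base: one vertex, one open edge),
trivial graph actions, admissible quotient bijective; NOT André's `π₁^temp` of a curve; no curve is asserted to
realise the datum; `hF` is NOT thereby proved at any genuine special fibre (it remains GAP row G-w4d059-g8-1).
Nothing here bears on [IUTchIII] Cor. 3.12; typed ≠ inhabited ≠ discharged.
-/

noncomputable section

namespace Literature.AnabelianGeometry.SemiGraphs

open CategoryTheory _root_.Topology
open scoped Pointwise
open ProfiniteSemiGraph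
open Literature.IUT.HodgeTheaters (profiniteCompletion toCompletion ZHat)

universe u

/-! ### 1. A copy of `Ẑ` in `F̂₂` through `η(a)` is the cusp group `C₀ = cl η⟨a⟩` -/

namespace TwistedCusps

/-- `C₀ = cl η⟨a⟩`: the twisted word `a b^0` is `a`. [cite: MochizukiSemiAnbd2006, Ex. 2.10 p.31] -/
theorem word_zero : word 0 = FreeGroup.of 0 := by
  simp [word]

/-- **A closed abelian subgroup of `F̂₂` containing `η(a)` IS `C₀`**: it contains `cl η⟨a⟩ = C₀`, and an element `z`
outside `C₀` commuting with `C₀` would give `C₀ ∩ z C₀ z⁻¹ = C₀ ≠ 1`, against the MALNORMALITY of `C₀`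
(`cusp_inf_conj_self_eq_bot`). [cite: MochizukiSemiAnbd2006, Ex. 2.10 p.31] -/
theorem eq_cusp_zero_of_comm {Z : Subgroup (profiniteCompletion (FreeGroup (Fin 2)))}
    (hZcl : IsClosed (Z : Set (profiniteCompletion (FreeGroup (Fin 2)))))
    (hZab : ∀ x ∈ Z, ∀ y ∈ Z, x * y = y * x)
    (ha : toCompletion (FreeGroup (Fin 2)) (FreeGroup.of 0) ∈ Z) : Z = cusp 0 := by
  have hle : cusp 0 ≤ Z := by
    unfold cusp
    refine Subgroup.topologicalClosure_minimal _ ?_ hZcl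
    rw [Subgroup.zpowers_le, word_zero]
    exact ha
  refine le_antisymm (fun z hz => ?_) hle
  by_contra hzC
  have hbot := cusp_inf_conj_self_eq_bot 0 hzC
  have hfix : cusp 0 ≤ ConjAct.toConjAct z • cusp 0 := by
    intro c hc
    rw [Subgroup.mem_pointwise_smul_iff_inv_smul_mem, ← ConjAct.toConjAct_inv, ConjAct.toConjAct_smul,
      inv_inv]
    have hcomm : z⁻¹ * c * z = c := by
      rw [hZab _ (Z.inv_mem hz) _ (hle hc), mul_assoc, inv_mul_cancel, mul_one]
    rw [hcomm]
    exact hc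
  have hC : cusp 0 = ⊥ := by
    rw [← le_bot_iff, ← hbot]
    exact le_inf le_rfl hfix
  haveI := infinite_cusp 0
  have hfin : Finite (cusp 0) := by rw [hC]; infer_instance
  exact not_finite (cusp 0)

/-- **A copy of `Ẑ` in `F̂₂` through `η(a)` is `C₀`** (closed: compact image; abelian: `Ẑ` is commutative).
[cite: MochizukiSemiAnbd2006, §6 p.71] -/
theorem eq_cusp_zero_of_zHat {Z : Subgroup (profiniteCompletion (FreeGroup (Fin 2)))} (eZ : Z ≃ₜ* ZHat)
    (ha : toCompletion (FreeGroup (Fin 2)) (FreeGroup.of 0) ∈ Z) : Z = cusp 0 := by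
  haveI : CompactSpace Z := eZ.toHomeomorph.symm.compactSpace
  have hZcl : IsClosed (Z : Set (profiniteCompletion (FreeGroup (Fin 2)))) :=
    (isCompact_iff_compactSpace.mpr ‹CompactSpace Z›).isClosed
  refine eq_cusp_zero_of_comm hZcl (fun x hx y hy => ?_) ha
  have h := zHat_conj_eq (eZ ⟨x, hx⟩) (eZ ⟨y, hy⟩)
  rw [← map_mul, ← map_inv, ← map_mul, eZ.injective.eq_iff] at h
  have h' := congrArg Subtype.val h
  simpa [mul_assoc] using (by
    have := h'
    change x * y * x⁻¹ = y at this
    calc x * y = x * y * x⁻¹ * x := by group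
      _ = y * x := by rw [this])

end TwistedCusps

/-! ### 2. The generic one-vertex cusped chart has a bijective verticial homomorphism -/

/-- **A BIJECTIVE verticial homomorphism `φ : Π_v ⥲ π₁^temp(graph)` of the one-vertex cusped chart**
`OneVertexCusps.restrictChart N C …` (group `N` on the nose): the compatible isomorphism of the chart with itself
([SemiAnbd] Prop. 3.6 (ii), `TemperedPiChart.exists_compatIso`) is a decomposition homomorphism of the cusp omission
`{v}` for the single-vertex chart, i.e. (`isDecompHom_singleVertex_iff`) a verticial homomorphism at `v`.
[cite: MochizukiSemiAnbd2006, Prop 3.6(ii) p.38] -/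
theorem OneVertexCusps.exists_bijective_isVerticialHom_restrictChart
    {Δ : Type u} [Group Δ] [TopologicalSpace Δ] [IsTopologicalGroup Δ] [CompactSpace Δ]
    [TotallyDisconnectedSpace Δ] [SecondCountableTopology Δ] {ι : Type u}
    (N : Subgroup Δ) (C : ι → Subgroup Δ) (hN : IsClosed (N : Set Δ)) (hC : ∀ k, IsClosed (C k : Set Δ)) :
    ∃ (φ ψ : ↥N →ₜ* ↥N), (∀ x, ψ (φ x) = x) ∧ (∀ y, φ (ψ y) = y) ∧
      ∀ v : (OneVertexCusps.restrictGraph N C hN hC).graph.Vertex,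
        IsVerticialHom (OneVertexCusps.restrictChart N C hN hC) v φ := by
  haveI hsc : SecondCountableTopology N := TopologicalSpace.Subtype.secondCountableTopology _
  obtain ⟨φ, ψ, h1, h2, ⟨i1⟩, -⟩ := TemperedPiChart.exists_compatIso
    (OneVertexCusps.restrictChart N C hN hC) (OneVertexCusps.restrictChart N C hN hC)
  refine ⟨φ, ψ, h1, h2, fun v => ?_⟩
  haveI : SecondCountableTopology ((OneVertexCusps.restrictGraph N C hN hC).Gv v) := hsc
  obtain ⟨⟩ := v
  rw [← TemperedPiChart.isDecompHom_singleVertex_iff]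
  exact ⟨i1⟩

/-! ### 3. The one-vertex-ONE-CUSP special-fibre datum over the cusped free-profinite 𝔛-datum -/

namespace SpecialFibreTower

variable (p : ℕ) [Fact p.Prime]

/-- **The binders `{hF, hdict}` of the hat-incidence reduction JOINTLY INHABITED, with a cusp AND an open edge
present**: there are `X`, `d`, a special-fibre datum `S` whose base fibre is the one-vertex-ONE-CUSP semi-graph of
anabelioids over `F̂₂` (vertex group `F̂₂`, open edge with edge group `C₀ = cl η⟨a⟩`), `T`, an origin record
`P : PiData X d S T` and a cusp `x` (`I_x ∩ Δ ↦ C₀`) such that, for EVERY level `i` and EVERY `h36`: `hF` holds at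
`(P.TpH, P.H)` (its conclusion is met by the abutting branch — `ℍ` contains the only vertex; `hF` stays a LABELLED
general fact-candidate) and `hdict` holds NON-DEGENERATELY — the branch `(⋆, true)` abuts to the vertex met by the
cusp, every abutting branch abuts to it, and `J_x = S.admissible(I_x ∩ Δ)` IS an edge-like subgroup of the open edge
(`map_branchSubgroup_mem_edgeLikeSubgroups` along the bijective verticial homomorphism `φ`).  Consistency evidence
for OUR binders only. [cite: MochizukiSemiAnbd2006, Ex 3.10 p.44] -/
theorem PiData.exists_hatEdgeIncidence_cuspEdgeDict_jointly :
    ∃ (X : TemperedCurve p) (d : X.GroupLevelData) (S : SpecialFibreData (X.toTemperedArithmeticGroup d))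
      (T : SpecialFibreTower X.DeltaTemp) (P : PiData X d S T),
      Nonempty {x : X.Pt // X.IsCusp x} ∧ Nonempty S.Gc.graph.Edge ∧
      ∀ (i : ℕ) (h36 : S.Gc.Prop36Hypotheses),
        (∀ (e : S.Gc.graph.Edge), ∀ L ∈ edgeLikeSubgroups S.chart e,
          ∀ g : (Literature.IUT.HodgeTheaters.TemperedGraphGroupData.exists_completion_of_prop36 S.Gc h36
            S.chart).choose,
            L.map (Literature.IUT.HodgeTheaters.TemperedGraphGroupData.exists_completion_of_prop36 S.Gc h36
              S.chart).choose_spec.choose.toMonoidHom ≤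
              MulAut.conj g • (P.TpH.map (Literature.IUT.HodgeTheaters.TemperedGraphGroupData.exists_completion_of_prop36
                S.Gc h36 S.chart).choose_spec.choose.toMonoidHom).topologicalClosure →
            ∃ b : S.Gc.graph.Branch, S.Gc.graph.edgeOf b = e ∧ ∃ w ∈ P.H.verts, S.Gc.graph.abuts b = some w) ∧
        (∀ x : {x : X.Pt // X.IsCusp x}, ∃ b : S.Gc.graph.Branch,
          S.Gc.graph.abuts b = some ((P.proj i).vertexMap (P.vtxOfCusp i x)) ∧
          (∀ b' : S.Gc.graph.Branch, S.Gc.graph.edgeOf b' = S.Gc.graph.edgeOf b →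
            ∀ w : S.Gc.graph.Vertex, S.Gc.graph.abuts b' = some w → w = (P.proj i).vertexMap (P.vtxOfCusp i x)) ∧
          ((X.inertia x.1).subgroupOf (X.toTemperedArithmeticGroup d).delta).map S.admissible.toMonoidHom ∈
            edgeLikeSubgroups S.chart (S.Gc.graph.edgeOf b)) := by
  classical
  obtain ⟨X, d, S₀, T, -, -, ⟨x₀, hx₀⟩, -, ⟨e, Z, -, ⟨eZ⟩, haZ, hIx⟩, -, -, -, ⟨P₀⟩, -, ⟨hUi, hEi, hBi, -, -, -⟩, -⟩ :=
    PiData.exists_temperedCurve_freeProfiniteTwo_cusped_exposed p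
  -- notation for the free profinite group and its subgroups
  haveI hsc : SecondCountableTopology (profiniteCompletion (FreeGroup (Fin 2))) :=
    secondCountableTopology_profiniteCompletion_freeGroup (Fin 2)
  have hZ : Z = TwistedCusps.cusp 0 := TwistedCusps.eq_cusp_zero_of_zHat eZ haZ
  have hNcl : IsClosed ((⊤ : Subgroup (profiniteCompletion (FreeGroup (Fin 2)))) :
      Set (profiniteCompletion (FreeGroup (Fin 2)))) := by
    rw [Subgroup.coe_top]; exact isClosed_univ
  have hNop : IsOpen ((⊤ : Subgroup (profiniteCompletion (FreeGroup (Fin 2)))) :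
      Set (profiniteCompletion (FreeGroup (Fin 2)))) := by
    rw [Subgroup.coe_top]; exact isOpen_univ
  have hC : ∀ _ : PUnit.{1}, IsClosed ((TwistedCusps.cusp 0 :
      Subgroup (profiniteCompletion (FreeGroup (Fin 2)))) : Set (profiniteCompletion (FreeGroup (Fin 2)))) :=
    fun _ => TwistedCusps.isClosed_cusp 0
  -- the base fibre, its Thm 3.7 hypotheses and its chart (abc-iut-L3-t11 lineage, by name)
  let Gc : ProfiniteSemiGraph.{0} :=
    OneVertexCusps.restrictGraph (ι := PUnit.{1}) ⊤ (fun _ => TwistedCusps.cusp 0) hNcl hC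
  have hyp : Gc.Thm37Hypotheses :=
    TwistedCusps.restrict_thm37Hypotheses_cusp ⊤ hNop (fun _ : PUnit.{1} => (0 : ℤ))
      (fun a b _ => Subsingleton.elim a b)
  let c : TemperedPiChart Gc := OneVertexCusps.restrictChart ⊤ (fun _ => TwistedCusps.cusp 0) hNcl hC
  -- a bijective verticial homomorphism of the chart
  obtain ⟨φ, ψ, hψφ, hφψ, hφv⟩ :=
    OneVertexCusps.exists_bijective_isVerticialHom_restrictChart ⊤ (fun _ : PUnit.{1} => TwistedCusps.cusp 0) hNcl hC
  -- the admissible quotient `Δ ≃ Δ^temp ≃ F̂₂ ≃ ⊤ →(φ) ⊤`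
  have hΔ : X.DeltaTemp = (X.toTemperedArithmeticGroup d).delta :=
    Literature.IUT.HodgeTheaters.StableCurveTemperedData.OfSpecialFibre.deltaTemp_eq_delta X d
  let castH : ↥(X.toTemperedArithmeticGroup d).delta →ₜ* ↥X.DeltaTemp :=
    { toMonoidHom := Subgroup.inclusion hΔ.symm.le
      continuous_toFun := continuous_inclusion hΔ.symm.le }
  let eH : ↥X.DeltaTemp →ₜ* profiniteCompletion (FreeGroup (Fin 2)) :=
    { toMonoidHom := e.symm.toMulEquiv.toMonoidHom
      continuous_toFun := e.symm.continuous }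
  let topH : profiniteCompletion (FreeGroup (Fin 2)) →ₜ* ↥(⊤ : Subgroup (profiniteCompletion (FreeGroup (Fin 2)))) :=
    { toMonoidHom := (Subgroup.topEquiv :
        (⊤ : Subgroup (profiniteCompletion (FreeGroup (Fin 2)))) ≃* _).symm.toMonoidHom
      continuous_toFun := Continuous.subtype_mk continuous_id _ }
  let adm : ↥(X.toTemperedArithmeticGroup d).delta →ₜ* c.G := φ.comp (topH.comp (eH.comp castH))
  have hadm_apply : ∀ z, adm z = φ ⟨e.symm ⟨z.1, hΔ.symm.le z.2⟩, trivial⟩ := fun z => rfl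
  have hadm_surj : Function.Surjective adm := by
    intro y
    obtain ⟨g, hg⟩ := e.symm.surjective ((ψ y : (⊤ : Subgroup _)) : profiniteCompletion (FreeGroup (Fin 2)))
    refine ⟨⟨g.1, hΔ.le g.2⟩, ?_⟩
    rw [hadm_apply]
    have hg' : (⟨g.1, hΔ.symm.le (hΔ.le g.2)⟩ : X.DeltaTemp) = g := Subtype.ext rfl
    have : (⟨e.symm ⟨g.1, hΔ.symm.le (hΔ.le g.2)⟩, trivial⟩ :
        (⊤ : Subgroup (profiniteCompletion (FreeGroup (Fin 2))))) = ψ y := by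
      apply Subtype.ext
      change e.symm ⟨g.1, _⟩ = _
      rw [hg', hg]
    rw [this, hφψ]
  have hadm_inj : Function.Injective adm := by
    intro z z' h
    rw [hadm_apply, hadm_apply] at h
    have h1 := congrArg ψ h
    rw [hψφ, hψφ] at h1
    have h2 := congrArg (fun t : (⊤ : Subgroup (profiniteCompletion (FreeGroup (Fin 2)))) =>
      (t : profiniteCompletion (FreeGroup (Fin 2)))) h1
    simp only at h2
    have h3 := e.symm.injective h2
    apply Subtype.ext
    exact congrArg (fun t : X.DeltaTemp => t.1) h3
  let S : SpecialFibreData (X.toTemperedArithmeticGroup d) := ⟨Gc, hyp, c, adm, hadm_surj⟩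
  -- the admissible kernel is trivial
  have hker : S.admissible.toMonoidHom.ker = ⊥ := (MonoidHom.ker_eq_bot_iff _).mpr hadm_inj
  -- the cusp omission `{v}` of the base fibre
  have hco : (⟨{PUnit.unit}, ∅⟩ : (OneVertexCusps.semiGraph PUnit.{1}).Subgraph).IsCuspOmission :=
    { verts_eq := Set.eq_univ_of_forall fun v => by cases v; exact Set.mem_singleton _
      existsUnique_abuts := fun k _ => ⟨(k, true), rfl, rfl, fun b' hb' hab => by
        obtain ⟨k', c'⟩ := b'
        cases hb'
        cases c'
        · cases hab
        · rfl⟩ }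
  -- the constant projections of the (one-vertex, edgeless) level fibres onto the base vertex
  let proj : ∀ i, ((T.Gc i).graph ⟶ S.Gc.graph) := fun i =>
    { vertexMap := fun _ => PUnit.unit
      edgeMap := fun e' => (hEi i).elim e'
      branchMap := fun b => (hBi i).elim b
      edgeOf_branchMap := fun b => (hBi i).elim b
      branchMap_injOn := fun b => (hBi i).elim b
      abuts_branchMap := fun b => (hBi i).elim b }
  haveI hss : Subsingleton S.Gc.graph.Vertex := inferInstanceAs (Subsingleton PUnit.{1})
  let P : PiData X d S T :=
    { admKer_normal_pi := P₀.admKer_normal_pi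
      admissibleKer_normal_pi := by rw [hker, Subgroup.map_bot]; infer_instance
      N_cofinal := P₀.N_cofinal
      finite := ⟨(inferInstance : Finite PUnit.{1}), (inferInstance : Finite PUnit.{1}),
        P₀.finite.finite_vertex, P₀.finite.finite_edge⟩
      actGraph := P₀.actGraph
      actGraph₀ := 1
      actGraph_vertexMap := P₀.actGraph_vertexMap
      actGraph₀_vertexMap := fun _ _ _ => Subsingleton.elim _ _
      proj := proj
      proj_vertex_surjective := fun i v => by
        obtain ⟨u⟩ := hUi i
        exact ⟨default, Subsingleton.elim _ _⟩
      proj_actGraph := fun i g => SemiGraph.hom_ext _ _ (funext fun _ => Subsingleton.elim _ _)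
        (funext fun e' => (hEi i).elim e') (funext fun b => (hBi i).elim b)
      H := ⟨{PUnit.unit}, ∅⟩
      H_connected := hco.isConnected OneVertexCusps.semiGraph_isConnected
      H_stable := fun g => ⟨fun v hv => by cases v; exact Set.mem_singleton _, fun e' he => he.elim⟩
      TpH := ⊤
      TpH_verticial := fun v _ => ⟨φ.toMonoidHom.range, ⟨φ, hφv v, rfl⟩, le_top⟩
      TpH_le := by
        intro g _
        apply Subgroup.le_topologicalClosure
        apply Subgroup.subset_closure
        refine Set.mem_iUnion₂.mpr ⟨PUnit.unit, Set.mem_singleton _, Set.mem_iUnion₂.mpr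
          ⟨φ.toMonoidHom.range, ⟨φ, hφv _, rfl⟩, ?_⟩⟩
        exact ⟨ψ g, hφψ g⟩
      baseVertex := PUnit.unit
      baseVertex_mem := Set.mem_singleton _
      baseLift := P₀.baseLift
      proj_baseLift := fun _ => rfl
      vtxOfCusp := P₀.vtxOfCusp
      proj_vtxOfCusp := fun _ _ _ => rfl
      inertia_le_verticial := P₀.inertia_le_verticial }
  -- `J_x = S.admissible(I_x ∩ Δ)` is the image of the branch group `C₀ ∩ ⊤` under the verticial `φ`
  have hinner : ∀ x : {x : X.Pt // X.IsCusp x},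
      ((X.inertia x.1).subgroupOf (X.toTemperedArithmeticGroup d).delta).map (topH.comp (eH.comp castH)).toMonoidHom =
        (TwistedCusps.cusp 0).subgroupOf ⊤ := by
    intro x
    ext t
    simp only [Subgroup.mem_map, Subgroup.mem_subgroupOf]
    constructor
    · rintro ⟨z, hz, rfl⟩
      rw [hIx] at hz
      obtain ⟨w', hw', hzw⟩ := hz
      obtain ⟨w, hw, rfl⟩ := hw'
      have hz1 : (⟨z.1, hΔ.symm.le z.2⟩ : X.DeltaTemp) = e w := Subtype.ext hzw.symm
      change (e.symm ⟨z.1, hΔ.symm.le z.2⟩ : profiniteCompletion (FreeGroup (Fin 2))) ∈ TwistedCusps.cusp 0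
      rw [hz1, ContinuousMulEquiv.symm_apply_apply, ← hZ]
      exact hw
    · intro ht
      refine ⟨⟨(e (t : profiniteCompletion (FreeGroup (Fin 2)))).1, hΔ.le (e _).2⟩, ?_, ?_⟩
      · rw [hIx]
        exact ⟨e (t : profiniteCompletion (FreeGroup (Fin 2))), ⟨_, hZ ▸ ht, rfl⟩, rfl⟩
      · apply Subtype.ext
        change e.symm ⟨(e (t : profiniteCompletion (FreeGroup (Fin 2)))).1, _⟩ = (t : profiniteCompletion (FreeGroup (Fin 2)))
        have : (⟨(e (t : profiniteCompletion (FreeGroup (Fin 2)))).1, hΔ.symm.le (hΔ.le (e _).2)⟩ : X.DeltaTemp) =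
            e (t : profiniteCompletion (FreeGroup (Fin 2))) := Subtype.ext rfl
        rw [this, ContinuousMulEquiv.symm_apply_apply]
  have hJ : ∀ x : {x : X.Pt // X.IsCusp x},
      ((X.inertia x.1).subgroupOf (X.toTemperedArithmeticGroup d).delta).map S.admissible.toMonoidHom =
        (Gc.branchSubgroup (PUnit.unit, true) PUnit.unit rfl).map φ.toMonoidHom := by
    intro x
    have hb : Gc.branchSubgroup (PUnit.unit, true) PUnit.unit rfl = (TwistedCusps.cusp 0).subgroupOf ⊤ := by
      change (OneVertexCusps.restrictEmb ⊤ (fun _ : PUnit.{1} => TwistedCusps.cusp 0) PUnit.unit).toMonoidHom.range = _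
      exact OneVertexCusps.range_restrictEmb _ _ _
    rw [hb, ← hinner x, Subgroup.map_map]
    rfl
  refine ⟨X, d, S, T, P, ⟨⟨x₀, hx₀⟩⟩, ⟨PUnit.unit⟩, fun i h36 => ⟨?_, fun x => ?_⟩⟩
  · intro e' _ _ _ _
    exact ⟨(e', true), rfl, PUnit.unit, Set.mem_singleton _, rfl⟩
  · refine ⟨(PUnit.unit, true), rfl, fun _ _ w _ => Subsingleton.elim _ _, ?_⟩
    rw [hJ x]
    exact map_branchSubgroup_mem_edgeLikeSubgroups c _ _ rfl (hφv _)

end SpecialFibreTower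

end Literature.AnabelianGeometry.SemiGraphs

/-! ### 4. Hence the p492945 closer FIRES at that datum -/

namespace Literature.IUT.HodgeTheaters

namespace StableCurveTemperedData

open Literature.AnabelianGeometry.SemiGraphs Literature.AnabelianGeometry.SemiGraphs.ProfiniteSemiGraph

/-- **Cor. 2.3 (vi) AS TYPED holds at the one-vertex-one-cusp witness, by the hat-incidence closer**: for any prime
sets `Σ ⊆ Σ̂` with `p ∉ Σ`, at `ofSpecialFibre X d S h36 Σ Σ̂ … P.TpH (closure ι(P.TpH)) _ (x ↦ "ξ_x meets P.H")` for the
witness's `X d S T P` — `cor23vi_ofSpecialFibre_closureH_piDataTpH_of_hatEdgeIncidence` (p492945) with BOTH binders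
`hF`, `hdict` inhabited (`SpecialFibreTower.PiData.exists_hatEdgeIncidence_cuspEdgeDict_jointly`), a cusp AND an open
edge present.  Consistency evidence only; FQ type per the gate rule. [cite: Mochizuki2012, Cor 2.3(vi) p.48]
[claim: Mochizuki2012, status: disputed] -/
theorem exists_cor23vi_ofSpecialFibre_of_hatEdgeIncidence (p : ℕ) [Fact p.Prime] (Sigma SigmaHat : Set ℕ)
    (hsub : Sigma ⊆ SigmaHat) (hne : Sigma.Nonempty) (hprime : ∀ q ∈ SigmaHat, q.Prime) (hp : p ∉ Sigma) :
    ∃ (X : TemperedCurve p) (d : X.GroupLevelData) (S : SpecialFibreData (X.toTemperedArithmeticGroup d))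
      (T : SpecialFibreTower X.DeltaTemp) (P : SpecialFibreTower.PiData X d S T) (h36 : S.Gc.Prop36Hypotheses),
      Nonempty {x : X.Pt // X.IsCusp x} ∧ Nonempty S.Gc.graph.Edge ∧
      ∀ i : ℕ, Literature.IUT.HodgeTheaters.StableCurveTemperedData.Cor23vi
        (ofSpecialFibre X d S h36 Sigma SigmaHat hsub hne hprime hp P.TpH ((P.TpH.map
          (TemperedGraphGroupData.exists_completion_of_prop36 S.Gc h36 S.chart).choose_spec.choose.toMonoidHom
          ).topologicalClosure) (Subgroup.le_topologicalClosure _)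
          (fun x => (P.proj i).vertexMap (P.vtxOfCusp i x) ∈ P.H.verts)) := by
  obtain ⟨X, d, S, T, P, hx, hE, hlaws⟩ :=
    SpecialFibreTower.PiData.exists_hatEdgeIncidence_cuspEdgeDict_jointly p
  refine ⟨X, d, S, T, P, S.hyp.toProp36Hypotheses, hx, hE, fun i => ?_⟩
  obtain ⟨hF, hdict⟩ := hlaws i S.hyp.toProp36Hypotheses
  exact cor23vi_ofSpecialFibre_closureH_piDataTpH_of_hatEdgeIncidence X d S S.hyp.toProp36Hypotheses Sigma SigmaHat
    hsub hne hprime hp P i hF hdict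

end StableCurveTemperedData

end Literature.IUT.HodgeTheaters

end
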